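import Summits.ValiantsHypothesis.ValiantsHypothesis.Theorems.GrenetZeonDualUnipotentThreeHalvesWordDefs
import Summits.ValiantsHypothesis.ValiantsHypothesis.Theorems.GrenetZeonDualUnipotentThreeHalvesRadicalCoarseningFineFlag
import Summits.ValiantsHypothesis.ValiantsHypothesis.Theorems.DualUnipotentThreeHalves.Negative.FlagCheapIndexBound

/-!
# `GrenetZeon.DualUnipotentThreeHalves` (stmt-ValiantsHypothesis-24318) — line «radical_split» §7: WORD–FLAG DUALITY
# `FlagAdaptedUpTo m k n M ↔ WordTame n k M₀ M₁` for one-variable pencils `M = M₀ + s·M₁`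

Port (val-lit merged desk, b71 (B) port pool; porter val-port-1 g2; text = val-idea-9 g4's §7, VERBATIM, credited) of
`Cruxes/DualUnipotentThreeHalves/Lines/radical_split.lean` @749d8538785a §7 (negation lens; kernel-checked there), over the
Theorems-side vocabulary `…Theorems.GrenetZeon.RadicalSplit.{word, WordTame, FlagAdaptedUpTo, …}`
(`…GrenetZeonDualUnipotentThreeHalvesWordDefs`, definitionally the workfile's).

The flag layer of S3b / R2 is WORD COMBINATORICS, exactly.  The landed negative lane
(`…Theorems.DualUnipotentThreeHalvesNegative.FlagCost.word_eq_zero_of_flagAdapted`, `level_bound_word`, p613488) is the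
direction «certificate ⇒ short `M₁`-rich words vanish».  Here the CONVERSE is proved in its sharp form and the two are
closed into an `iff`: for a one-variable pencil `M(s) = M₀ + s·M₁` (no `s²`), `FlagAdaptedUpTo m k n M` holds IFF the
pair `(M₀, M₁)` is WORD-TAME with budget `k` (`WordTame`): there are a climb `c ≥ 1`, a drop `r` and a height `Θ` with
`⌊(Θ + r(n−1))/(c+r)⌋ ≤ k` such that EVERY NONZERO WORD `w` in `{M₀, M₁}` satisfies `c·#M₁(w) ≤ Θ + r·#M₀(w)`
(`flagAdaptedUpTo_of_wordTame`; `wordTame_of_flagAdaptedUpTo` needs `k + 2 ≤ n`, automatic under `(k+1)·n < dim K`;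
`flagAdaptedUpTo_iff_wordTame`).  The certifying flag is CANONICAL — the sublevel chain
`F_t = ⋂ {ker w : Θ + r·#M₀(w) < c·#M₁(w) + t}` of the word valuation — so a certificate never requires a search over
bases (`flagAdaptedUpTo_of_chain` is the general `(r, c)` form of the landed `flagAdaptedUpTo_of_flag`, FlagCoords).
The refuter's ENEMY CRITERION in word form: `not_wordTame_of_word` (a nonzero word of length `≤ n − 1` with `> k` letters
`M₁` kills word-tameness with budget `k`).  The pencil level (`flagCheap_iff_wordTame`, `not_flagCheap_of_words`, the laws
in word currency) is the sibling file `…WordFlagPencil`.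

Inputs by name: `…GrenetZeon.RadicalCoarsening.{exists_adapted_set, coeff_conj_apply, conj_entry_eq_repr,
toMatrix'_equivFun_mul_symm, toMatrix'_symm_mul_equivFun}` (port-3 g0, R1 chain) and
`…DualUnipotentThreeHalvesNegative.FlagCost.{level_bound_word, word_conj}` (val-neg-2, p613488).

Honest framing.  Helper lemmas (`--supports stmt-ValiantsHypothesis-24318 --as helper`), the atomic combinatorial content of
what a prover / refuter of R2 must decide; nothing here bears on `per_n`; S3b, R2 `HeavyTopLaw`, the crux
`DualUnipotentThreeHalves`, rung 8062 and `VP ≠ VNP` are untouched / NOT proved.  [folklore] (weighted path potentials /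
sublevel flags of a valuation); [p613488] for the ⇒ half.
-/

-- `Summit.ValiantsHypothesis.ValiantsHypothesis.…` repeats a component by the D-0017 layout
-- (single-conjunct summit), which the `dupNamespace` linter flags; the name is mandated.
set_option linter.dupNamespace false

noncomputable section

namespace Summit.ValiantsHypothesis.ValiantsHypothesis.Theorems.GrenetZeon.RadicalSplit

open MvPolynomial Matrix
open scoped BigOperators
open Summit.ValiantsHypothesis.ValiantsHypothesis.Cruxes.TwoDimCoefficients.DimTwoCases (AffMat IsAffine)
open Summit.ValiantsHypothesis.ValiantsHypothesis.Theorems.GrenetZeon.RadicalCoarsening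
  (exists_adapted_set coeff_conj_apply conj_entry_eq_repr toMatrix'_equivFun_mul_symm toMatrix'_symm_mul_equivFun)
open Summit.ValiantsHypothesis.ValiantsHypothesis.Theorems.DualUnipotentThreeHalvesNegative.FlagCost
  (level_bound_word word_conj)

variable {m : ℕ}

/-- The empty word is the identity. -/
theorem word_nil (T₀ T₁ : Matrix (Fin m) (Fin m) ℂ) : word T₀ T₁ [] = 1 := by
  simp [word]

/-- Appending a letter multiplies the word on the right. -/
theorem word_append_singleton (T₀ T₁ : Matrix (Fin m) (Fin m) ℂ) (w : List Bool) (b : Bool) :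
    word T₀ T₁ (w ++ [b]) = word T₀ T₁ w * (if b then T₁ else T₀) := by
  simp [word, List.map_append, List.prod_append]

/-- **Adapted basis from a stable chain, general drop/climb** (the `(r, c)` form of the landed `flagAdaptedUpTo_of_flag`).
An antitone chain `F 0 = ⊤ ⊇ ⋯ ⊇ F L = ⊥` which the constant part `M₀` lowers by at most `r` steps and the `s`-part `M₁`
raises by at least `c ≥ 1` steps yields `FlagAdaptedUpTo m k n M` with `p = L`, drop `r`, weight `a + 1 = c + r`,
whenever `⌊(L − 1 + r(n−1))/(c+r)⌋ ≤ k`. [folklore; FlagCoords `flagAdaptedUpTo_of_flag` is `r = 0, c = 1`] -/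
theorem flagAdaptedUpTo_of_chain (F : ℕ → Submodule ℂ (Fin m → ℂ)) (hanti : Antitone F) (hF0 : F 0 = ⊤) {L : ℕ}
    (hFL : F L = ⊥) (M : Matrix (Fin m) (Fin m) (MvPolynomial (Fin 1) ℂ)) (r c : ℕ) (hc : 1 ≤ c)
    (h0 : ∀ t, ∀ w ∈ F t, (M.map (coeff 0)).mulVec w ∈ F (t - r))
    (h1 : ∀ t, ∀ w ∈ F t, (M.map (coeff (Finsupp.single 0 1))).mulVec w ∈ F (t + c))
    (h2 : ∀ d : Fin 1 →₀ ℕ, 2 ≤ d 0 → ∀ i j, coeff d (M i j) = 0) {n k : ℕ}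
    (hk : (L - 1 + r * (n - 1)) / (c + r) ≤ k) :
    FlagAdaptedUpTo m k n M := by
  classical
  obtain ⟨B, lvl, hli, hsp, hmemF, hlvlL, hspan⟩ := exists_adapted_set F hanti hF0 L hFL
  have hli' : LinearIndependent ℂ (fun u : B => (u : Fin m → ℂ)) := hli.linearIndependent
  have hsp' : ⊤ ≤ Submodule.span ℂ (Set.range fun u : B => (u : Fin m → ℂ)) := by
    rw [Subtype.range_coe, hsp]
  let bB : Module.Basis B ℂ (Fin m → ℂ) := Module.Basis.mk hli' hsp'
  haveI : Fintype B := hli'.setFinite.fintype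
  have hcard : Fintype.card B = m := by
    have h := Module.finrank_eq_card_basis bB
    rw [Module.finrank_fin_fun] at h
    exact h.symm
  let e : B ≃ Fin m := Fintype.equivFinOfCardEq hcard
  let b : Module.Basis (Fin m) ℂ (Fin m → ℂ) := bB.reindex e
  have hb : ∀ i, b i = ((e.symm i : B) : Fin m → ℂ) := fun i => by
    show (bB.reindex e) i = _
    rw [Module.Basis.reindex_apply, Module.Basis.mk_apply]
  have hbmem : ∀ i, b i ∈ B := fun i => by rw [hb]; exact (e.symm i).2
  -- coordinates supported on high levels
  have key : ∀ (t : ℕ) (w : Fin m → ℂ), w ∈ F t → ∀ i, b.repr w i ≠ 0 → t ≤ lvl (b i) := by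
    intro t w hw i hi
    have hw' : w ∈ Submodule.span ℂ (b '' {i | t ≤ lvl (b i)}) := by
      refine Submodule.span_mono ?_ (hspan t hw)
      rintro u ⟨huB, hut⟩
      refine ⟨e ⟨u, huB⟩, ?_, ?_⟩
      · show t ≤ lvl (b (e ⟨u, huB⟩))
        rw [hb, Equiv.symm_apply_apply]
        exact hut
      · rw [hb, Equiv.symm_apply_apply]
    have hsub := b.repr_support_subset_of_mem_span _ hw'
    exact hsub (Finsupp.mem_support_iff.2 hi)
  -- the change of basis
  let Q : Matrix (Fin m) (Fin m) ℂ := LinearMap.toMatrix' (b.equivFun : (Fin m → ℂ) →ₗ[ℂ] (Fin m → ℂ))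
  let P : Matrix (Fin m) (Fin m) ℂ := LinearMap.toMatrix' (b.equivFun.symm : (Fin m → ℂ) →ₗ[ℂ] (Fin m → ℂ))
  let g : (Matrix (Fin m) (Fin m) ℂ)ˣ :=
    ⟨Q, P, toMatrix'_equivFun_mul_symm b, toMatrix'_symm_mul_equivFun b⟩
  have hcr : 1 ≤ c + r := by omega
  unfold FlagAdaptedUpTo flagDeg FlagAdapted
  refine ⟨g, fun i => lvl (b i), L, r, c + r - 1, ?_, ?_, ?_⟩
  · -- levels are `< L`: a basis vector of level `L` would lie in `F L = ⊥`
    intro i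
    rcases (hlvlL (b i) (hbmem i)).lt_or_eq with hlt | heq
    · exact hlt
    · exfalso
      have hmem := hmemF (b i) (hbmem i)
      rw [heq, hFL, Submodule.mem_bot] at hmem
      exact b.ne_zero i hmem
  · rw [Nat.sub_add_cancel hcr]; exact hk
  · intro i j d hd
    show (c + r - 1 + 1) * d 0 + lvl (b j) ≤ lvl (b i) + r
    rw [Nat.sub_add_cancel hcr]
    have hg : ((g : (Matrix (Fin m) (Fin m) ℂ)ˣ) : Matrix (Fin m) (Fin m) ℂ) = Q := rfl
    have hg' : ((g⁻¹ : (Matrix (Fin m) (Fin m) ℂ)ˣ) : Matrix (Fin m) (Fin m) ℂ) = P := rfl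
    rw [hg, hg', coeff_conj_apply] at hd
    have hdd : d = Finsupp.single 0 (d 0) := by
      refine Finsupp.ext fun t => ?_
      have ht : t = 0 := Subsingleton.elim t 0
      subst ht
      rw [Finsupp.single_eq_same]
    rcases Nat.lt_or_ge (d 0) 2 with hlt | hge
    · rcases (show d 0 = 0 ∨ d 0 = 1 by omega) with h | h
      · -- constant part: drops by at most `r`
        have hd0 : d = 0 := by rw [hdd, h, Finsupp.single_zero]
        rw [hd0, conj_entry_eq_repr] at hd
        have hw : (M.map (coeff 0)).mulVec (b j) ∈ F (lvl (b j) - r) := h0 _ _ (hmemF _ (hbmem j))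
        have hle := key _ _ hw i hd
        rw [h]
        omega
      · -- `s`-part: climbs by at least `c`
        have hd1 : d = Finsupp.single 0 1 := by rw [hdd, h]
        rw [hd1, conj_entry_eq_repr] at hd
        have hw : (M.map (coeff (Finsupp.single 0 1))).mulVec (b j) ∈ F (lvl (b j) + c) :=
          h1 _ _ (hmemF _ (hbmem j))
        have hle := key _ _ hw i hd
        rw [h]
        omega
    · -- no higher powers of `s`
      exfalso
      apply hd
      have hz : M.map (coeff d) = 0 := by
        ext k l
        rw [Matrix.map_apply, Matrix.zero_apply]
        exact h2 d hge k l
      rw [hz, Matrix.mul_zero, Matrix.zero_mul, Matrix.zero_apply]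

/-- **Word-tame ⇒ flag certificate** (the converse of p613488, with the CANONICAL flag).  If the pair
`(M₀, M₁) = (coeff_{s⁰} M, coeff_{s¹} M)` is word-tame with budget `k` (and `M` has no `s²`), then `FlagAdaptedUpTo m k n M`:
the certifying chain is `F_t = ⋂ {ker (word w) : Θ + r·#M₀(w) < c·#M₁(w) + t}` (`F_0 = ⊤` because the words outside the
profile vanish, `F_{Θ+1} = ⊥` by the empty word, `M₁ F_t ⊆ F_{t+c}` and `M₀ F_t ⊆ F_{t−r}` by appending a letter).
[this file; folklore] -/
theorem flagAdaptedUpTo_of_wordTame (M : Matrix (Fin m) (Fin m) (MvPolynomial (Fin 1) ℂ))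
    (h2 : ∀ d : Fin 1 →₀ ℕ, 2 ≤ d 0 → ∀ i j, coeff d (M i j) = 0) {n k : ℕ}
    (hW : WordTame n k (M.map (coeff 0)) (M.map (coeff (Finsupp.single 0 1)))) :
    FlagAdaptedUpTo m k n M := by
  classical
  obtain ⟨r, c, Θ, hc, hk, hwords⟩ := hW
  set T₀ : Matrix (Fin m) (Fin m) ℂ := M.map (coeff 0) with hT₀
  set T₁ : Matrix (Fin m) (Fin m) ℂ := M.map (coeff (Finsupp.single 0 1)) with hT₁
  -- words outside the profile vanish
  have hzero : ∀ w : List Bool, Θ + r * w.count false < c * w.count true → word T₀ T₁ w = 0 := by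
    intro w hw
    by_contra hne
    have := hwords w hne
    omega
  -- the canonical sublevel chain of the word valuation
  let S : ℕ → Set (List Bool) := fun t => {w | Θ + r * w.count false < c * w.count true + t}
  let F : ℕ → Submodule ℂ (Fin m → ℂ) :=
    fun t => ⨅ w ∈ S t, LinearMap.ker (Matrix.mulVecLin (word T₀ T₁ w))
  have hmem : ∀ t v, v ∈ F t ↔ ∀ w ∈ S t, (word T₀ T₁ w).mulVec v = 0 := by
    intro t v
    simp only [F, Submodule.mem_iInf, LinearMap.mem_ker, Matrix.mulVecLin_apply]
  have hS : ∀ t w, w ∈ S t ↔ Θ + r * w.count false < c * w.count true + t := fun t w => Iff.rfl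
  have hct : ∀ w : List Bool, (w ++ [true]).count true = w.count true + 1 := fun w => by simp
  have hcf : ∀ w : List Bool, (w ++ [true]).count false = w.count false := fun w => by simp
  have hct' : ∀ w : List Bool, (w ++ [false]).count true = w.count true := fun w => by simp
  have hcf' : ∀ w : List Bool, (w ++ [false]).count false = w.count false + 1 := fun w => by simp
  have hanti : Antitone F := by
    intro t t' htt' v hv
    rw [hmem] at hv ⊢
    intro w hw
    exact hv w (by rw [hS] at hw ⊢; omega)
  have hF0 : F 0 = ⊤ := by
    rw [eq_top_iff]
    intro v _
    rw [hmem]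
    intro w hw
    rw [hS] at hw
    rw [hzero w (by omega), Matrix.zero_mulVec]
  have hFL : F (Θ + 1) = ⊥ := by
    rw [eq_bot_iff]
    intro v hv
    rw [hmem] at hv
    have h := hv [] (by rw [hS]; simp)
    rw [word_nil, Matrix.one_mulVec] at h
    rw [Submodule.mem_bot]
    exact h
  have h1 : ∀ t, ∀ v ∈ F t, T₁.mulVec v ∈ F (t + c) := by
    intro t v hv
    rw [hmem] at hv ⊢
    intro w hw
    have hw' : w ++ [true] ∈ S t := by
      rw [hS] at hw ⊢
      rw [hct, hcf]
      have : c * (w.count true + 1) = c * w.count true + c := by ring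
      omega
    have h := hv _ hw'
    rw [word_append_singleton] at h
    simpa [Matrix.mulVec_mulVec] using h
  have h0 : ∀ t, ∀ v ∈ F t, T₀.mulVec v ∈ F (t - r) := by
    intro t v hv
    rw [hmem] at hv ⊢
    intro w hw
    rw [hS] at hw
    rcases Nat.lt_or_ge t r with htr | htr
    · -- `t < r`: the word itself lies outside the profile
      have ht0 : t - r = 0 := Nat.sub_eq_zero_of_le htr.le
      rw [ht0, add_zero] at hw
      rw [hzero w hw, Matrix.zero_mulVec]
    · have hw' : w ++ [false] ∈ S t := by
        rw [hS, hct', hcf']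
        have : r * (w.count false + 1) = r * w.count false + r := by ring
        omega
      have h := hv _ hw'
      rw [word_append_singleton] at h
      simpa [Matrix.mulVec_mulVec] using h
  exact flagAdaptedUpTo_of_chain F hanti hF0 hFL M r c hc h0 h1 h2 (by rw [Nat.add_sub_cancel]; exact hk)

/-- **Flag certificate ⇒ word-tame** (p613488 `level_bound_word`, read as a profile bound): from an adapted basis with
levels `< p`, drop `r`, weight `a + 1` and budget `≤ k ≤ n − 2` one gets `r ≤ a` and the profile
`(a + 1 − r)·#M₁(w) ≤ (p − 1) + r·#M₀(w)` on every nonzero word. [p613488; this file] -/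
theorem wordTame_of_flagAdaptedUpTo (M : Matrix (Fin m) (Fin m) (MvPolynomial (Fin 1) ℂ)) {n k : ℕ}
    (hkn : k + 2 ≤ n) (h : FlagAdaptedUpTo m k n M) :
    WordTame n k (M.map (coeff 0)) (M.map (coeff (Finsupp.single 0 1))) := by
  classical
  obtain ⟨g, lvl, p, r, a, hl, hk, hA⟩ := h
  unfold flagDeg at hk
  set T₀ : Matrix (Fin m) (Fin m) ℂ := M.map (coeff 0) with hT₀
  set T₁ : Matrix (Fin m) (Fin m) ℂ := M.map (coeff (Finsupp.single 0 1)) with hT₁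
  set G : Matrix (Fin m) (Fin m) ℂ := (g : Matrix (Fin m) (Fin m) ℂ) with hG
  set G' : Matrix (Fin m) (Fin m) ℂ := (↑g⁻¹ : Matrix (Fin m) (Fin m) ℂ) with hG'
  have hGG' : G * G' = 1 := by rw [hG, hG']; exact Units.mul_inv g
  have hG'G : G' * G = 1 := by rw [hG, hG']; exact Units.inv_mul g
  have h0 : ∀ i j, (G * T₀ * G') i j ≠ 0 → lvl j ≤ lvl i + r := by
    intro i j hij
    rw [hT₀, ← coeff_conj_apply] at hij
    have := hA i j 0 hij
    simpa using this
  have h1 : ∀ i j, (G * T₁ * G') i j ≠ 0 → (a + 1) + lvl j ≤ lvl i + r := by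
    intro i j hij
    rw [hT₁, ← coeff_conj_apply] at hij
    have := hA i j (Finsupp.single 0 1) hij
    simpa using this
  -- the drop never exceeds the weight when the budget is `≤ n − 2`
  have hra : r ≤ a := by
    by_contra hlt
    push Not at hlt
    have h3 : n - 1 ≤ (p - 1 + r * (n - 1)) / (a + 1) := by
      rw [Nat.le_div_iff_mul_le (by omega : 0 < a + 1)]
      have : (n - 1) * (a + 1) ≤ r * (n - 1) := by
        rw [Nat.mul_comm]
        exact Nat.mul_le_mul_right _ hlt
      omega
    omega
  refine ⟨r, a + 1 - r, p - 1, by omega, ?_, fun w hw => ?_⟩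
  · rw [Nat.sub_add_cancel (by omega : r ≤ a + 1)]
    exact hk
  · -- a nonzero word: conjugate it and read the levels off with `level_bound_word`
    have hne : (w.map fun b => if b then G * T₁ * G' else G * T₀ * G').prod ≠ 0 := by
      rw [word_conj G G' T₁ T₀ hGG' hG'G w]
      intro hzero
      apply hw
      have hw' : word T₀ T₁ w = G' * (G * (w.map fun b => if b then T₁ else T₀).prod * G') * G := by
        unfold word
        calc (w.map fun b => if b then T₁ else T₀).prod
            = (G' * G) * (w.map fun b => if b then T₁ else T₀).prod * (G' * G) := by
              rw [hG'G, Matrix.one_mul, Matrix.mul_one]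
          _ = G' * (G * (w.map fun b => if b then T₁ else T₀).prod * G') * G := by
              simp only [Matrix.mul_assoc]
      rw [hw', hzero, Matrix.mul_zero, Matrix.zero_mul]
    obtain ⟨i, j, hij⟩ : ∃ i j, (w.map fun b => if b then G * T₁ * G' else G * T₀ * G').prod i j ≠ 0 := by
      by_contra hall
      push Not at hall
      exact hne (Matrix.ext fun i j => by rw [hall i j, Matrix.zero_apply])
    have hb := level_bound_word (G * T₀ * G') (G * T₁ * G') lvl (a + 1) r h0 h1 w i j hij
    have hi := hl i
    have hlen : w.count false + w.count true = w.length := by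
      simp
    have hsplit : r * w.length = r * w.count false + r * w.count true := by
      rw [← hlen, Nat.mul_add]
    rw [hsplit] at hb
    rw [Nat.sub_mul]
    generalize (a + 1) * List.count true w = A at hb ⊢
    generalize r * List.count true w = Rc at hb ⊢
    generalize r * List.count false w = Rf at hb ⊢
    omega

/-- **WORD–FLAG DUALITY.** For `k + 2 ≤ n` and `M = M₀ + s·M₁` with no `s²`:
`FlagAdaptedUpTo m k n M ↔ WordTame n k M₀ M₁`. [this file] -/
theorem flagAdaptedUpTo_iff_wordTame (M : Matrix (Fin m) (Fin m) (MvPolynomial (Fin 1) ℂ))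
    (h2 : ∀ d : Fin 1 →₀ ℕ, 2 ≤ d 0 → ∀ i j, coeff d (M i j) = 0) {n k : ℕ} (hkn : k + 2 ≤ n) :
    FlagAdaptedUpTo m k n M ↔ WordTame n k (M.map (coeff 0)) (M.map (coeff (Finsupp.single 0 1))) :=
  ⟨wordTame_of_flagAdaptedUpTo M hkn, flagAdaptedUpTo_of_wordTame M h2⟩

/-- **The refuter's kill, word form** (`word_eq_zero_of_flagAdapted` of p613488 in dual currency): ONE nonzero word of
length `≤ n − 1` with more than `k` letters `T₁` forbids word-tameness with budget `k`. [p613488; this file] -/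
theorem not_wordTame_of_word {n k : ℕ} (T₀ T₁ : Matrix (Fin m) (Fin m) ℂ) (w : List Bool)
    (hw : word T₀ T₁ w ≠ 0) (he : k < w.count true) (hl : w.length ≤ n - 1) : ¬ WordTame n k T₀ T₁ := by
  rintro ⟨r, c, Θ, hc, hk, hW⟩
  have hb := hW w hw
  have hlen : w.count false + w.count true = w.length := by
    simp
  -- `⌊(Θ + r(n-1))/(c+r)⌋ ≤ k < #T₁` gives `Θ + r(n-1) < (c+r)·#T₁`
  have hlt : Θ + r * (n - 1) < (c + r) * w.count true := by
    by_contra hge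
    push Not at hge
    have : w.count true ≤ (Θ + r * (n - 1)) / (c + r) :=
      (Nat.le_div_iff_mul_le (by omega)).2 (by rw [Nat.mul_comm]; exact hge)
    omega
  have hr : r * w.count false + r * w.count true ≤ r * (n - 1) := by
    rw [← Nat.mul_add, hlen]
    exact Nat.mul_le_mul_left _ hl
  rw [Nat.add_mul] at hlt
  generalize c * List.count true w = Ct at hb hlt
  generalize r * List.count true w = Rt at hlt hr
  generalize r * List.count false w = Rf at hb hr
  generalize r * (n - 1) = Rn at hlt hr
  omega

end Summit.ValiantsHypothesis.ValiantsHypothesis.Theorems.GrenetZeon.RadicalSplit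

end
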